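import Literature.Geometry.Riemannian.ThreeShrinkerDegenerateDeckModel
import HarnessLib

/-!
# Degenerate three-dimensional shrinkers: deck transformations of the developing map

Continuation of `ThreeShrinkerDegenerateDeckModel` (degenerate case of Munteanu–Wang 2016, Thm. 1.2).
For a developing map `Φ : C → M` (`IsDeveloping`) of a degenerate shrinker we study the set
`deckSet Φ` of **model maps** `m` (`y ↦ cQy`, `y ↦ cQy/|y|²`) with `Φ ∘ m = Φ`:

* `deck_eq_id` — a deck map with a fixed point is the identity (its 1-jet at the fixed point is
  that of `id`, by injectivity of `dΦ`; rigidity of local isometries of `g_c`);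
* `exists_deck_apply_eq` — **transitivity on fibres**: if `Φ y₁ = Φ y₂` there is a deck map with
  `m y₁ = y₂`. The linear isometry `L = (dΦ_{y₂})⁻¹ dΦ_{y₁}` of `(T_{y₁}C, g_c) → (T_{y₂}C, g_c)`
  maps the radial vector `y₁` to `± y₂`, because `dΦ` sends radial vectors to the null line of
  `Ric`, which is one-dimensional (`null_eq_or_eq_neg`); accordingly `L` is the differential at `y₁`
  of `y ↦ cQy` or of `y ↦ cQ H_{y₁} y/|y|²`, and rigidity (`Φ ∘ m` and `Φ` are local isometries
  `C → M` with the same 1-jet at `y₁`) gives `Φ ∘ m = Φ`.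

Also: Euler's fixed-vector theorem for `SO(3)` (`IsOrtho.exists_fixed_of_det_eq_one`, via
`det(Q − 1) = det(1 − Qᵀ) = −det(Q − 1)`), used for the count of `deckSet Φ` in
`ThreeShrinkerDegenerateFibre`.

Everything is proved; `IsModelMap`/`deckSet` are definitions (no named facts, D-0026).

## References

* O. Munteanu, J. Wang, arXiv:1606.01861, Thm. 1.2 (p. 3). [MunteanuWang2016]
* B. O'Neill, *Semi-Riemannian Geometry*, Academic Press 1983, Ch. 3, Prop. 3.62; Ch. 7, Cor. 29.
  [ONeill1983]
* P. Petersen, W. Wylie, Geom. Topol. 14 (2010), §3. [PetersenWylie2010]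
-/

noncomputable section

open Bundle Set Function Filter Module Metric
open scoped Manifold ContDiff Topology NNReal RealInnerProductSpace

namespace Literature.Geometry.Riemannian

open Lorentzian Lorentzian.PseudoRiemannianMetric RoundCylinderThree

namespace RoundCylinderThree

/-! ### Orthogonal maps of `ℝ³`: determinant `±1` and Euler's fixed vector -/

namespace IsOrtho

variable {Q : E3 →L[ℝ] E3}

/-- `Qᵀ Q = 1` for an orthogonal `Q`. [folklore] -/
theorem adjoint_comp (hQ : IsOrtho Q) :
    LinearMap.adjoint (Q : E3 →ₗ[ℝ] E3) ∘ₗ (Q : E3 →ₗ[ℝ] E3) = LinearMap.id := by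
  apply LinearMap.ext
  intro u
  apply ext_inner_right ℝ
  intro w
  rw [LinearMap.comp_apply, LinearMap.adjoint_inner_left, LinearMap.id_apply]
  exact hQ u w

end IsOrtho

/-- `det Aᵀ = det A` on `ℝ³`. [folklore] -/
theorem det_adjoint_eq (A : E3 →ₗ[ℝ] E3) : LinearMap.det (LinearMap.adjoint A) = LinearMap.det A := by
  set b := stdOrthonormalBasis ℝ E3 with hb
  rw [← LinearMap.det_toMatrix b.toBasis, LinearMap.toMatrix_adjoint, Matrix.det_conjTranspose,
    LinearMap.det_toMatrix, star_trivial]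

namespace IsOrtho

variable {Q : E3 →L[ℝ] E3}

/-- `(det Q)² = 1` for an orthogonal `Q`. [folklore] -/
theorem det_sq (hQ : IsOrtho Q) : LinearMap.det (Q : E3 →ₗ[ℝ] E3) * LinearMap.det (Q : E3 →ₗ[ℝ] E3) = 1 := by
  have h := congrArg LinearMap.det hQ.adjoint_comp
  rw [LinearMap.det_comp, det_adjoint_eq, LinearMap.det_id] at h
  exact h

/-- `det Q = ±1` for an orthogonal `Q`. [folklore] -/
theorem det_eq_or (hQ : IsOrtho Q) :
    LinearMap.det (Q : E3 →ₗ[ℝ] E3) = 1 ∨ LinearMap.det (Q : E3 →ₗ[ℝ] E3) = -1 :=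
  mul_self_eq_one_iff.1 hQ.det_sq

/-- **Euler's rotation theorem**: an orthogonal map of `ℝ³` with `det = 1` fixes a nonzero vector
(`det(Q − 1) = det Q · det(1 − Qᵀ) = det(1 − Q) = (−1)³ det(Q − 1)`). [folklore] -/
theorem exists_fixed_of_det_eq_one (hQ : IsOrtho Q) (hdet : LinearMap.det (Q : E3 →ₗ[ℝ] E3) = 1) :
    ∃ v : E3, v ≠ 0 ∧ Q v = v := by
  set A : E3 →ₗ[ℝ] E3 := (Q : E3 →ₗ[ℝ] E3) with hA
  set B : E3 →ₗ[ℝ] E3 := LinearMap.adjoint A with hB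
  have hBA : B * A = 1 := hQ.adjoint_comp
  have hAB : A * B = 1 := by rwa [mul_eq_one_comm] at hBA
  have h3 : Module.finrank ℝ E3 = 3 := finrank_euclideanSpace_fin
  have e1 : A - 1 = A * (1 - B) := by rw [mul_sub, mul_one, hAB]
  have e2 : (1 : E3 →ₗ[ℝ] E3) - B = LinearMap.adjoint (1 - A) := by
    rw [map_sub, hB, Module.End.one_eq_id, LinearMap.adjoint_id]
  have e3 : LinearMap.det (A - 1) = LinearMap.det (1 - A) := by
    rw [e1, map_mul, hdet, one_mul, e2, det_adjoint_eq]
  have e4 : LinearMap.det ((1 : E3 →ₗ[ℝ] E3) - A) = -LinearMap.det (A - 1) := by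
    rw [show (1 : E3 →ₗ[ℝ] E3) - A = (-1 : ℝ) • (A - 1) by rw [neg_one_smul, neg_sub],
      LinearMap.det_smul, h3]
    norm_num
  have hdet0 : LinearMap.det (A - 1) = 0 := by linarith
  obtain ⟨v, hv, hv0⟩ := Submodule.exists_mem_ne_zero_of_ne_bot
    (LinearMap.det_eq_zero_iff_ker_ne_bot.1 hdet0)
  refine ⟨v, hv0, ?_⟩
  have h : (A - 1) v = 0 := hv
  rw [LinearMap.sub_apply, Module.End.one_apply, sub_eq_zero] at h
  exact h

end IsOrtho

/-- An involution without nonzero fixed vectors is `−1` (`v + Qv` is fixed). [folklore] -/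
theorem eq_neg_of_sq_eq {Q : E3 →L[ℝ] E3} (h2 : ∀ u, Q (Q u) = u) (hfix : ∀ v, Q v = v → v = 0)
    (u : E3) : Q u = -u := by
  have h : Q (u + Q u) = u + Q u := by rw [map_add, h2, add_comm]
  have h0 := hfix _ h
  exact eq_neg_of_add_eq_zero_right h0

/-- `det(−Q) = −det Q` on `ℝ³`. [folklore] -/
theorem det_neg (Q : E3 →L[ℝ] E3) :
    LinearMap.det ((-Q : E3 →L[ℝ] E3) : E3 →ₗ[ℝ] E3) = -LinearMap.det (Q : E3 →ₗ[ℝ] E3) := by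
  have h3 : Module.finrank ℝ E3 = 3 := finrank_euclideanSpace_fin
  rw [ContinuousLinearMap.toLinearMap_neg, show -(Q : E3 →ₗ[ℝ] E3) = (-1 : ℝ) • (Q : E3 →ₗ[ℝ] E3) by
    rw [neg_one_smul], LinearMap.det_smul, h3]
  norm_num

/-- `det(Q Q') = det Q · det Q'`. [folklore] -/
theorem det_comp (Q Q' : E3 →L[ℝ] E3) :
    LinearMap.det ((Q.comp Q' : E3 →L[ℝ] E3) : E3 →ₗ[ℝ] E3) =
      LinearMap.det (Q : E3 →ₗ[ℝ] E3) * LinearMap.det (Q' : E3 →ₗ[ℝ] E3) := by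
  rw [ContinuousLinearMap.toLinearMap_comp, LinearMap.det_comp]

/-! ### Model maps -/

/-- **Model maps of the cylinder**: `y ↦ cQy` or `y ↦ cQy/|y|²` with `c > 0`, `Q ∈ O(3)`.
[folklore] -/
def IsModelMap (m : P3 → P3) : Prop :=
  ∃ (c : ℝ) (Q : E3 →L[ℝ] E3), 0 < c ∧ IsOrtho Q ∧ (m = scaleLin c Q ∨ m = scaleInv c Q)

namespace IsModelMap

variable {m m' : P3 → P3}

/-- Model maps are smooth. [folklore] -/
theorem contMDiff (hm : IsModelMap m) : ContMDiff 𝓘(ℝ, E3) 𝓘(ℝ, E3) ∞ m := by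
  obtain ⟨c, Q, hc, hQ, h | h⟩ := hm
  · rw [h]; exact contMDiff_scaleLin hc hQ
  · rw [h]; exact contMDiff_scaleInv hc hQ

/-- Model maps are isometries of `g_c`. [folklore] -/
theorem iso (hm : IsModelMap m) (y : P3) (u w : E3) :
    cyl3.val (m y) (mfderiv 𝓘(ℝ, E3) 𝓘(ℝ, E3) m y u) (mfderiv 𝓘(ℝ, E3) 𝓘(ℝ, E3) m y w) =
      cyl3.val y u w := by
  obtain ⟨c, Q, hc, hQ, h | h⟩ := hm
  · subst h; exact cyl3_scaleLin hc hQ y u w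
  · subst h; exact cyl3_scaleInv hc hQ y u w

/-- Model maps are closed under composition. [folklore] -/
theorem comp (hm : IsModelMap m) (hm' : IsModelMap m') : IsModelMap (m ∘ m') := by
  obtain ⟨c, Q, hc, hQ, h | h⟩ := hm <;> obtain ⟨c', Q', hc', hQ', h' | h'⟩ := hm' <;> subst h h'
  · exact ⟨_, _, mul_pos hc hc', hQ.comp hQ', Or.inl (scaleLin_scaleLin hc hQ hc' hQ')⟩
  · exact ⟨_, _, mul_pos hc hc', hQ.comp hQ', Or.inr (scaleLin_scaleInv hc hQ hc' hQ')⟩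
  · exact ⟨_, _, div_pos hc hc', hQ.comp hQ', Or.inr (scaleInv_scaleLin hc hQ hc' hQ')⟩
  · exact ⟨_, _, div_pos hc hc', hQ.comp hQ', Or.inl (scaleInv_scaleInv hc hQ hc' hQ')⟩

/-- `id` is a model map. [folklore] -/
theorem id : IsModelMap (_root_.id : P3 → P3) :=
  ⟨1, ContinuousLinearMap.id ℝ E3, one_pos, IsOrtho.id, Or.inl scaleLin_one_id.symm⟩

end IsModelMap

end RoundCylinderThree

/-! ### The null line of `Ric` -/

variable {M : Type*} [TopologicalSpace M] [ChartedSpace (EuclideanSpace ℝ (Fin 3)) M]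
  [IsManifold (𝓡 3) ∞ M]
  (g : PseudoRiemannianMetric (𝓡 3) ∞ (EuclideanSpace ℝ (Fin 3)) (TangentSpace (𝓡 3) : M → Type _))
  [g.HasLeviCivita]

namespace DegenerateShrinker

section Along

variable [T2Space M] [ConnectedSpace M]
  (hg : ∀ (x : M) (v : TangentSpace (𝓡 3) x), v ≠ 0 → 0 < g.val x v v)
  {f : M → ℝ} (hf : ContMDiff (𝓡 3) 𝓘(ℝ, ℝ) ∞ f) {lam : ℝ}
  (hsol : ∀ (x : M) (X Y : TangentSpace (𝓡 3) x),
    g.ricci x X Y + g.hessian f x X Y = lam * g.val x X Y)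
  (hRic0 : ∀ (x : M) (w : TangentSpace (𝓡 3) x), 0 ≤ g.ricci x w w)
  (hS : ∀ x, 0 < g.scalarCurvature x) {p₀ : M} {w₀ : TangentSpace (𝓡 3) p₀} (hw₀ : w₀ ≠ 0)
  (hnull : g.ricci p₀ w₀ w₀ = 0)
  {κ : (x : M) → TangentSpace (𝓡 3) x → ℝ}
  (hκ : ∀ (x : M) (w : TangentSpace (𝓡 3) x),
    κ x w = g.val x w w - 2 / g.scalarCurvature x * g.ricci x w w)

omit [T2Space M] in
include hg hf hsol hRic0 hS hw₀ hnull hκ in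
/-- **`Ric`-null vectors are multiples of the unit null vector** (`Ric(w,w) = (S/2)(|w|² − g(ν,w)²)`
and Cauchy–Schwarz). [cite: PetersenWylie2010, §3] -/
theorem eq_smul_of_ricci_eq_zero {x : M} {ν : TangentSpace (𝓡 3) x} (hνν : g.val x ν ν = 1)
    (hν : g.ricci x ν ν = 0) {w : TangentSpace (𝓡 3) x} (hw : g.ricci x w w = 0) :
    w = (g.val x ν w) • ν := by
  set a := g.val x ν w with ha
  have hk := kappa_eq_sq_of_unit_null g hg hf hsol hRic0 hS hw₀ hnull hκ hνν hν w
  have hr := ricci_eq_of_kappa g hS hκ x w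
  rw [hw, hk, ← ha] at hr
  have hS2 : g.scalarCurvature x / 2 ≠ 0 := div_ne_zero (hS x).ne' two_ne_zero
  have hww : g.val x w w = a ^ 2 := by
    have h := (mul_eq_zero.1 hr.symm).resolve_left hS2
    linarith
  by_contra hne
  have hu : w - a • ν ≠ 0 := sub_ne_zero.2 hne
  have hpos := hg x _ hu
  have hsy : g.val x w ν = a := by rw [ha]; exact g.symm x w ν
  have h0 : g.val x (w - a • ν) (w - a • ν) = 0 := by
    simp only [map_sub, map_smul, sub_apply, smul_apply, smul_eq_mul, hww, hνν, hsy, ← ha]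
    ring
  linarith

omit [T2Space M] in
include hg hf hsol hRic0 hS hw₀ hnull hκ in
/-- **The null cone of `Ric` is a line**: two `Ric`-null vectors of the same length `√2` are equal
or opposite. [cite: PetersenWylie2010, §3] [cite: MunteanuWang2016, Thm. 1.2] -/
theorem null_eq_or_eq_neg {x : M} {n₁ n₂ : TangentSpace (𝓡 3) x} (h1 : g.val x n₁ n₁ = 2)
    (r1 : g.ricci x n₁ n₁ = 0) (h2 : g.val x n₂ n₂ = 2) (r2 : g.ricci x n₂ n₂ = 0) :
    n₁ = n₂ ∨ n₁ = -n₂ := by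
  obtain ⟨ν, hνν, hν0⟩ := exists_unit_null g hg hf hsol hRic0 hS hw₀ hnull x
  have hν : g.ricci x ν ν = 0 := (hν0 ν).1
  set a₁ := g.val x ν n₁ with ha₁
  set a₂ := g.val x ν n₂ with ha₂
  have e1 : n₁ = a₁ • ν := eq_smul_of_ricci_eq_zero g hg hf hsol hRic0 hS hw₀ hnull hκ hνν hν r1
  have e2 : n₂ = a₂ • ν := eq_smul_of_ricci_eq_zero g hg hf hsol hRic0 hS hw₀ hnull hκ hνν hν r2
  have hsq1 : a₁ ^ 2 = 2 := by
    rw [e1] at h1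
    simp only [map_smul, smul_apply, smul_eq_mul, hνν] at h1
    nlinarith [h1]
  have hsq2 : a₂ ^ 2 = 2 := by
    rw [e2] at h2
    simp only [map_smul, smul_apply, smul_eq_mul, hνν] at h2
    nlinarith [h2]
  have hprod : (a₁ - a₂) * (a₁ + a₂) = 0 := by nlinarith
  rcases mul_eq_zero.1 hprod with h | h
  · left
    rw [e1, e2, show a₁ = a₂ by linarith]
  · right
    rw [e1, e2, show a₁ = -a₂ by linarith, neg_smul]

end Along

/-! ### Deck transformations -/

/-- **The deck set** of `Φ`: model maps `m` with `Φ ∘ m = Φ`. [folklore] -/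
def deckSet (Φ : P3 → M) : Set (P3 → P3) := {m | IsModelMap m ∧ ∀ y, Φ (m y) = Φ y}

variable {g} {f : M → ℝ} {Φ : P3 → M}

omit [TopologicalSpace M] [ChartedSpace (EuclideanSpace ℝ (Fin 3)) M] [IsManifold (𝓡 3) ∞ M]
  [g.HasLeviCivita] in
/-- `id ∈ deckSet Φ`. [folklore] -/
theorem id_mem_deckSet : (_root_.id : P3 → P3) ∈ deckSet Φ := ⟨IsModelMap.id, fun _ ↦ rfl⟩

omit [TopologicalSpace M] [ChartedSpace (EuclideanSpace ℝ (Fin 3)) M] [IsManifold (𝓡 3) ∞ M]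
  [g.HasLeviCivita] in
/-- `deckSet Φ` is closed under composition. [folklore] -/
theorem comp_mem_deckSet {m m' : P3 → P3} (hm : m ∈ deckSet Φ) (hm' : m' ∈ deckSet Φ) :
    m ∘ m' ∈ deckSet Φ :=
  ⟨hm.1.comp hm'.1, fun y ↦ by rw [Function.comp_apply, hm.2, hm'.2]⟩

namespace IsDeveloping

/-- **The chain rule for a deck map, read in the model space**:
`dΦ_{m y}(dm_y v) = dΦ_y v`. [folklore] -/
theorem mfderiv_deck_apply (hdev : IsDeveloping g f Φ) {m : P3 → P3} (hm : m ∈ deckSet Φ)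
    (y : P3) (v : E3) :
    @Eq (EuclideanSpace ℝ (Fin 3))
      (mfderiv 𝓘(ℝ, E3) (𝓡 3) Φ (m y) (mfderiv 𝓘(ℝ, E3) 𝓘(ℝ, E3) m y v))
      (mfderiv 𝓘(ℝ, E3) (𝓡 3) Φ y v) := by
  have hcomp : Φ ∘ m = Φ := funext hm.2
  have hc := mfderiv_comp y (hdev.smooth.mdifferentiableAt (by simp))
    (hm.1.contMDiff.mdifferentiableAt (by simp)) (I' := 𝓘(ℝ, E3)) (g := Φ) (f := m)
  have h2 := congrArg (fun F : P3 → M ↦ (mfderiv 𝓘(ℝ, E3) (𝓡 3) F y v : EuclideanSpace ℝ (Fin 3)))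
    hcomp
  simp only at h2
  rw [hc] at h2
  exact h2

/-- **A deck map with a fixed point is the identity** (its 1-jet at the fixed point is that of
`id` since `dΦ` is injective; rigidity of local isometries of `g_c` on the connected `C`).
[cite: ONeill1983, Ch. 3, Prop. 3.62] -/
theorem deck_eq_id (hdev : IsDeveloping g f Φ) {m : P3 → P3} (hm : m ∈ deckSet Φ) {y₀ : P3}
    (hfix : m y₀ = y₀) : m = id := by
  have key := hdev.mfderiv_deck_apply hm y₀
  have T : ∀ p : P3, m y₀ = p → ∀ v : E3,
      @Eq (EuclideanSpace ℝ (Fin 3))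
        (mfderiv 𝓘(ℝ, E3) (𝓡 3) Φ p (mfderiv 𝓘(ℝ, E3) 𝓘(ℝ, E3) m y₀ v))
        (mfderiv 𝓘(ℝ, E3) (𝓡 3) Φ y₀ v) := by
    intro p hp v
    subst hp
    exact key v
  have hdm : ∀ v : E3, @Eq E3 (mfderiv 𝓘(ℝ, E3) 𝓘(ℝ, E3) m y₀ v) v :=
    fun v ↦ hdev.injective_mfderiv y₀ (T y₀ hfix v)
  have hdim : finrank ℝ E3 = finrank ℝ E3 := rfl
  have hrig := IsometryRigidity.eqOn_of_isometry_of_oneJet_eq (I := 𝓘(ℝ, E3)) (I' := 𝓘(ℝ, E3))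
    (g := cyl3) (gN := cyl3) (f₁ := m) (f₂ := _root_.id) hdim isOpen_univ isPreconnected_univ
    hm.1.contMDiff.contMDiffOn contMDiff_id.contMDiffOn
    (fun y _ u w ↦ hm.1.iso y u w)
    (fun y _ u w ↦ by rw [mfderiv_id]; rfl) (mem_univ y₀) hfix
    (by
      apply ContinuousLinearMap.ext
      intro v
      rw [mfderiv_id]
      exact hdm v)
  exact funext fun y ↦ hrig (mem_univ y)

section Trans

variable [T2Space M] [ConnectedSpace M]
  (hg : ∀ (x : M) (v : TangentSpace (𝓡 3) x), v ≠ 0 → 0 < g.val x v v)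
  (hf : ContMDiff (𝓡 3) 𝓘(ℝ, ℝ) ∞ f) {lam : ℝ}
  (hsol : ∀ (x : M) (X Y : TangentSpace (𝓡 3) x),
    g.ricci x X Y + g.hessian f x X Y = lam * g.val x X Y)
  (hRic0 : ∀ (x : M) (w : TangentSpace (𝓡 3) x), 0 ≤ g.ricci x w w)
  (hS : ∀ x, 0 < g.scalarCurvature x) {p₀ : M} {w₀ : TangentSpace (𝓡 3) p₀} (hw₀ : w₀ ≠ 0)
  (hnull : g.ricci p₀ w₀ w₀ = 0)
  {κ : (x : M) → TangentSpace (𝓡 3) x → ℝ}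
  (hκ : ∀ (x : M) (w : TangentSpace (𝓡 3) x),
    κ x w = g.val x w w - 2 / g.scalarCurvature x * g.ricci x w w)

include hg hf hsol hRic0 hS hw₀ hnull hκ in
/-- **Transitivity of deck maps on fibres**: if `Φ y₁ = Φ y₂` there is a model map `m` with
`Φ ∘ m = Φ` and `m y₁ = y₂` (see the module docstring). [cite: ONeill1983, Ch. 7, Cor. 29]
[cite: MunteanuWang2016, Thm. 1.2] -/
theorem exists_deck_apply_eq (hdev : IsDeveloping g f Φ) {y₁ y₂ : P3} (hx : Φ y₁ = Φ y₂) :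
    ∃ m ∈ deckSet Φ, m y₁ = y₂ := by
  -- the differentials and `L = (dΦ_{y₂})⁻¹ dΦ_{y₁}`
  set A₁ := mfderiv 𝓘(ℝ, E3) (𝓡 3) Φ y₁ with hA₁
  set A₂ := mfderiv 𝓘(ℝ, E3) (𝓡 3) Φ y₂ with hA₂
  set e₂ := mfderivEquivOfInjective (I := 𝓡 3) (I' := 𝓘(ℝ, E3)) Φ y₂ (hdev.injective_mfderiv y₂)
    IsDeveloping.hdim with he₂
  set L : E3 →ₗ[ℝ] E3 :=
    (e₂.symm : TangentSpace (𝓡 3) (Φ y₂) →ₗ[ℝ] TangentSpace 𝓘(ℝ, E3) y₂).comp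
      ((A₁ : TangentSpace 𝓘(ℝ, E3) y₁ →L[ℝ] TangentSpace (𝓡 3) (Φ y₁)) :
        TangentSpace 𝓘(ℝ, E3) y₁ →ₗ[ℝ] TangentSpace (𝓡 3) (Φ y₁)) with hL
  have hAL : ∀ v : E3, @Eq (EuclideanSpace ℝ (Fin 3)) (A₂ (L v)) (A₁ v) := fun v ↦
    mfderiv_mfderivEquivOfInjective_symm (I := 𝓡 3) (I' := 𝓘(ℝ, E3)) Φ y₂
      (hdev.injective_mfderiv y₂) IsDeveloping.hdim (A₁ v)
  set r₁ : ℝ := ‖(y₁ : E3)‖ with hr₁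
  set r₂ : ℝ := ‖(y₂ : E3)‖ with hr₂
  have hr₁0 : 0 < r₁ := norm_pos y₁
  have hr₂0 : 0 < r₂ := norm_pos y₂
  -- transport of `g` along `Φ y₁ = Φ y₂` (model-space typed vectors)
  have Tg : ∀ a b : EuclideanSpace ℝ (Fin 3), g.val (Φ y₂) a b = g.val (Φ y₁) a b := by
    have T : ∀ p : M, Φ y₁ = p → ∀ a b : EuclideanSpace ℝ (Fin 3),
        g.val p a b = g.val (Φ y₁) a b := by
      intro p hp a b; subst hp; rfl
    exact T _ hx
  have Tr : ∀ a : EuclideanSpace ℝ (Fin 3), g.ricci (Φ y₂) a a = g.ricci (Φ y₁) a a := by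
    have T : ∀ p : M, Φ y₁ = p → ∀ a : EuclideanSpace ℝ (Fin 3),
        g.ricci p a a = g.ricci (Φ y₁) a a := by
      intro p hp a; subst hp; rfl
    exact T _ hx
  -- `L` is a similarity: `⟨Lu, Lw⟩ = (r₂²/r₁²)⟨u, w⟩`
  have hLiso : ∀ u w : E3, ⟪L u, L w⟫ = r₂ ^ 2 / r₁ ^ 2 * ⟪u, w⟫ := by
    intro u w
    have h1 := hdev.iso y₂ (L u) (L w)
    have h2 := hdev.iso y₁ u w
    rw [cyl3_apply] at h1 h2
    rw [← hr₂] at h1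
    rw [← hr₁] at h2
    have h1' : g.val (Φ y₂) (A₂ (L u)) (A₂ (L w)) = 2 / r₂ ^ 2 * ⟪L u, L w⟫ := h1
    rw [hAL u, hAL w, Tg] at h1'
    have h2' : g.val (Φ y₁) (A₁ u) (A₁ w) = 2 / r₁ ^ 2 * ⟪u, w⟫ := h2
    rw [h2'] at h1'
    field_simp at h1'
    field_simp
    linarith
  -- radial vectors: `L y₁ = ± y₂`
  obtain ⟨g1, ric1⟩ := hdev.radial y₁
  obtain ⟨g2, ric2⟩ := hdev.radial y₂
  have hLy : L y₁ = (y₂ : E3) ∨ L y₁ = -(y₂ : E3) := by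
    have g1' : g.val (Φ y₂) (A₁ (y₁ : E3)) (A₁ (y₁ : E3)) = 2 := by rw [Tg]; exact g1
    have ric1' : g.ricci (Φ y₂) (A₁ (y₁ : E3)) (A₁ (y₁ : E3)) = 0 := by rw [Tr]; exact ric1
    have hn := null_eq_or_eq_neg g hg hf hsol hRic0 hS hw₀ hnull hκ (x := Φ y₂) g1' ric1' g2 ric2
    rcases hn with h | h
    · left
      apply hdev.injective_mfderiv y₂
      have e : @Eq (EuclideanSpace ℝ (Fin 3)) (A₂ (L (y₁ : E3))) (A₁ (y₁ : E3)) := hAL (y₁ : E3)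
      exact e.trans h
    · right
      apply hdev.injective_mfderiv y₂
      have e : @Eq (EuclideanSpace ℝ (Fin 3)) (A₂ (L (y₁ : E3))) (A₁ (y₁ : E3)) := hAL (y₁ : E3)
      have e2 : @Eq (EuclideanSpace ℝ (Fin 3)) (A₂ (-(y₂ : E3))) (-(A₂ (y₂ : E3))) := map_neg A₂ _
      exact (e.trans h).trans e2.symm
  -- the orthogonal part `Q = (r₁/r₂) L`
  set Lc : E3 →L[ℝ] E3 := LinearMap.toContinuousLinearMap L with hLc
  have hLcv : ∀ v, Lc v = L v := fun v ↦ rfl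
  set Q : E3 →L[ℝ] E3 := (r₁ / r₂) • Lc with hQdef
  have hQv : ∀ v, Q v = (r₁ / r₂) • L v := fun v ↦ rfl
  have hQ : IsOrtho Q := by
    intro u w
    rw [hQv, hQv, real_inner_smul_left, real_inner_smul_right, hLiso]
    field_simp
  -- a model map with the 1-jet `(y₂, L)` at `y₁`
  obtain ⟨m, hmod, hm1, hdm⟩ : ∃ m : P3 → P3, IsModelMap m ∧ m y₁ = y₂ ∧
      ∀ v : E3, @Eq E3 (mfderiv 𝓘(ℝ, E3) 𝓘(ℝ, E3) m y₁ v) (L v) := by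
    rcases hLy with hL1 | hL1
    · refine ⟨scaleLin (r₂ / r₁) Q, ⟨_, _, div_pos hr₂0 hr₁0, hQ, Or.inl rfl⟩, ?_, ?_⟩
      · apply Subtype.ext
        rw [coe_scaleLin (div_pos hr₂0 hr₁0) hQ, linE, hQv, smul_smul,
          show r₂ / r₁ * (r₁ / r₂) = 1 by field_simp, one_smul, hL1]
      · intro v
        rw [mfderiv_scaleLin_apply (div_pos hr₂0 hr₁0) hQ, hQv, smul_smul,
          show r₂ / r₁ * (r₁ / r₂) = 1 by field_simp, one_smul]
    · have hy₁ : (y₁ : E3) ≠ 0 := coe_ne_zero y₁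
      refine ⟨scaleInv (r₁ * r₂) (Q.comp (Hh (y₁ : E3))),
        ⟨_, _, mul_pos hr₁0 hr₂0, hQ.comp (isOrtho_Hh hy₁), Or.inr rfl⟩, ?_, ?_⟩
      · apply Subtype.ext
        rw [coe_scaleInv (mul_pos hr₁0 hr₂0) (hQ.comp (isOrtho_Hh hy₁)), invE,
          ContinuousLinearMap.comp_apply, Hh_self hy₁, map_neg, hQv, ← hr₁, smul_neg, smul_smul,
          show r₁ * r₂ * (r₁ ^ 2)⁻¹ * (r₁ / r₂) = 1 by field_simp, one_smul, hL1, neg_neg]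
      · intro v
        rw [mfderiv_scaleInv_apply (mul_pos hr₁0 hr₂0) (hQ.comp (isOrtho_Hh hy₁)),
          ContinuousLinearMap.comp_apply, Hh_Hh hy₁, hQv, ← hr₁, smul_smul,
          show r₁ * r₂ * (r₁ ^ 2)⁻¹ * (r₁ / r₂) = 1 by field_simp, one_smul]
  -- rigidity: `Φ ∘ m = Φ`
  have hms := hmod.contMDiff
  have hΦm : ∀ y, Φ (m y) = Φ y := by
    have h0 : (Φ ∘ m) y₁ = Φ y₁ := by
      change Φ (m y₁) = Φ y₁
      rw [hm1]
      exact hx.symm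
    have h1 : @Eq (E3 →L[ℝ] EuclideanSpace ℝ (Fin 3)) (mfderiv 𝓘(ℝ, E3) (𝓡 3) (Φ ∘ m) y₁)
        (mfderiv 𝓘(ℝ, E3) (𝓡 3) Φ y₁) := by
      rw [mfderiv_comp y₁ (hdev.smooth.mdifferentiableAt (by simp)) (hms.mdifferentiableAt (by simp))]
      have J : ∀ p : P3, y₂ = p →
          ∀ B : TangentSpace 𝓘(ℝ, E3) y₁ →L[ℝ] TangentSpace 𝓘(ℝ, E3) p,
          (∀ v : E3, @Eq E3 (B v) (L v)) →
          @Eq (E3 →L[ℝ] EuclideanSpace ℝ (Fin 3)) ((mfderiv 𝓘(ℝ, E3) (𝓡 3) Φ p).comp B)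
            (mfderiv 𝓘(ℝ, E3) (𝓡 3) Φ y₁) := by
        intro p hp B hB
        subst hp
        apply ContinuousLinearMap.ext
        intro v
        have e := hAL v
        rw [← hB v] at e
        exact e
      exact J (m y₁) hm1.symm _ hdm
    have hrig := IsometryRigidity.eqOn_of_isometry_of_oneJet_eq (I := 𝓡 3) (I' := 𝓘(ℝ, E3))
      (g := g) (gN := cyl3) (f₁ := Φ ∘ m) (f₂ := Φ) IsDeveloping.hdim isOpen_univ
      isPreconnected_univ (hdev.smooth.comp hms).contMDiffOn hdev.smooth.contMDiffOn
      (fun y _ u w ↦ by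
        rw [mfderiv_comp y (hdev.smooth.mdifferentiableAt (by simp)) (hms.mdifferentiableAt (by simp))]
        change g.val (Φ (m y)) (mfderiv 𝓘(ℝ, E3) (𝓡 3) Φ (m y) (mfderiv 𝓘(ℝ, E3) 𝓘(ℝ, E3) m y u))
          (mfderiv 𝓘(ℝ, E3) (𝓡 3) Φ (m y) (mfderiv 𝓘(ℝ, E3) 𝓘(ℝ, E3) m y w)) = _
        rw [hdev.iso (m y), hmod.iso y u w])
      (fun y _ u w ↦ hdev.iso y u w) (mem_univ y₁) h0 h1
    intro y
    exact hrig (mem_univ y)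
  exact ⟨m, ⟨hmod, hΦm⟩, hm1⟩

end Trans

end IsDeveloping

end DegenerateShrinker

end Literature.Geometry.Riemannian

end
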